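import Literature.AlgebraicGeometry.HodgeTheory.MotivatedClassesLefschetzRange
import Literature.AlgebraicGeometry.HodgeTheory.LefschetzOneOneHolds
import Literature.AlgebraicGeometry.Motives.FamiliesVHS
import HarnessLib

/-!
# Crux `HodgeConjectureQbar` (stmt-HodgeConjecture-11596), line `registered`: stub A — the Lefschetz range

Registered stub `stub_hodgeClassesAlgebraicQbar_lefschetzRange` of the reshaped skeleton
`Cruxes/HodgeConjectureQbar/Lines/birth.lean` of the crux
`Summit.HodgeConjecture.HodgeConjecture.Theses.PeriodDeficiency.HodgeConjectureQbar` (the Hodge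
conjecture, on the real carriers, for smooth projective complex varieties with a `ℚ̄`-model):
in the LEFSCHETZ RANGE of codimensions `p ≤ 1 ∨ n ≤ p + 1` every rational `(p,p)`-class on
`X₀ ×_{ℚ̄,σ} ℂ` is algebraic. This is known mathematics and a theorem of the tree for EVERY smooth
projective complex `n`-fold (the `ℚ̄`-structure is not used): `p = 0` is `N⁰ H⁰ = H⁰`, `p = 1` is
Lefschetz's theorem on `(1,1)`-classes (Voisin I Thm. 11.30; tree theorem
`lefschetzOneOne_rational_holds`, via Kodaira–Serre and GAGA), `n < 2p` with `n − p ≤ 1` comes by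
hard Lefschetz from codimension `n − p` (Voisin I Thm. 6.25; tree theorem
`nonempty_hardLefschetzNFold_holds` through `mem_algebraicClasses_of_lt_of_nonempty`), and `p > n`
is `c = 0` — assembled in `mem_algebraicClasses_of_lefschetzRange`
(`HodgeTheory/MotivatedClassesLefschetzRange`). In particular the crux holds in every codimension
when `n ≤ 3` (Murre 1977, Remark 1; the tree's `hodgeConjectureFor_of_dim_le_three_holds`).

## References

* [VoisinHodgeI2002] C. Voisin, Hodge Theory and Complex Algebraic Geometry I (2002), Thm. 6.25,
  Rem. 6.27, §7.1.2, Thm. 11.30.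
* [Murre1977] J. P. Murre, On the Hodge conjecture for unirational fourfolds, Indag. Math. 80
  (1977), Remark 1.
* [Andre1996Motifs] Y. André, Pour une théorie inconditionnelle des motifs, Publ. Math. IHÉS 83
  (1996), §2.1 (the cut of the remaining range along motivated classes).
-/

set_option linter.dupNamespace false

namespace Summit.HodgeConjecture.HodgeConjecture.Theorems

open Literature.AlgebraicGeometry.Motives Literature.AlgebraicGeometry.HodgeTheory

/-- **Stub A of the crux `HodgeConjectureQbar` (line `registered`) — the Lefschetz range is
algebraic.** For every embedding `σ : ℚ̄ →+* ℂ`, every smooth projective `X = X₀ ×_{ℚ̄,σ} ℂ` of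
dimension `n` and every codimension `p` with `p ≤ 1 ∨ n ≤ p + 1`, every rational class of Hodge
type `(p,p)` in `H²ᵖ(X(ℂ); ℂ)` lies in `algebraicClasses X p = Nᵖ H²ᵖ(X(ℂ); ℂ)`: Lefschetz `(1,1)`
(`lefschetzOneOne_rational_holds`) and hard Lefschetz (`nonempty_hardLefschetzNFold_holds`) through
the tree's `mem_algebraicClasses_of_lefschetzRange`. Unconditional (no named-fact hypothesis). -/
theorem stub_hodgeClassesAlgebraicQbar_lefschetzRange :
    ∀ (σ : AlgebraicClosure ℚ →+* ℂ) ⦃n : ℕ⦄ ⦃X₀ : SchemeOver (AlgebraicClosure ℚ)⦄,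
      IsSmoothProjective n ((baseChangeHom σ).obj X₀) →
        ∀ (p : ℕ), (p ≤ 1 ∨ n ≤ p + 1) →
          ∀ (c : complexBetti ((baseChangeHom σ).obj X₀) (2 * p)),
            IsRationalClass c → IsOfHodgeType n ((baseChangeHom σ).obj X₀) (2 * p) p p c →
              c ∈ algebraicClasses ((baseChangeHom σ).obj X₀) p :=
  fun σ n X₀ hX _ hp c hc hpp ↦
    mem_algebraicClasses_of_lefschetzRange lefschetzOneOne_rational_holds
      (nonempty_hardLefschetzNFold_holds n ((baseChangeHom σ).obj X₀)) hX hp c hc hpp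

end Summit.HodgeConjecture.HodgeConjecture.Theorems
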